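import Summits.Ventures.PercRepro0.Coupling
import Mathlib.Probability.Independence.InfinitePi

/-! # The law of the block indicators of a threshold configuration (p6)

Generic support for the kernel twin of Corollary C of R_MID-13 · CRIT-FRAGILE
(proofs/CRITFRAGILE-plan-1-v1.md §4; module `CritFragileCor`): let `(U_b)_{b ∈ ι}` be the i.i.d. uniform
family of the threshold coupling (Coupling: `unif`, `threshold`, `map_threshold_eq_setBernoulli`) and let
`B e ⊆ ι`, `e ∈ κ`, be pairwise disjoint finite blocks. The BLOCK INDICATORS
`e ↦ [e ∈ u ∧ ∀ b ∈ B e, U b ≤ q]` («every bond of the block is open at level `q`») are independent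
Bernoulli(`q^{|B e|}`) variables: their joint law is the product of the coordinate laws
(`map_blockInd_eq`), obtained by re-indexing the uniform family along the blocks
(`Measure.map_infinitePi_infinitePi_of_inj`), currying the product over the blocks
(`Measure.infinitePi_map_piCurry`) and reading each block on its own bonds (`Measure.infinitePi_map_pi`).
The per-coordinate threshold process `e ↦ [e ∈ u ∧ V e ≤ q^{|B e|}]` of a uniform family `(V_e)_{e ∈ κ}`
has the same law (`map_blockThr_eq`) and contains the Bernoulli(`q^K`) threshold configuration pointwise
when every block on `u` has at most `K` bonds; hence STOCHASTIC DOMINATION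
(`setBernoulli_pow_le_map_blockConfig`): `setBer(u, q^K)(A) ≤ P(blockConfig ∈ A)` for every increasing
measurable `A`. This replaces the paper's uniformisation `W_e = (max_{b ∈ π_e} V_b)^{ℓ_e}`.
Inputs: Coupling (p5) on Defs verbatim; Mathlib's `Measure.infinitePi` API.
-/

namespace Summit.Ventures.PercRepro0.SubdivisionLaw

open MeasureTheory ProbabilityTheory unitInterval Set
open scoped ENNReal
open Summit.Ventures.PercRepro0.Defs

variable {ι κ : Type*}

/-- The per-block parameter `q^{|B e|}` as an element of the unit interval. -/
def blockParam (B : κ → Finset ι) (q : I) (e : κ) : I := q ^ (B e).card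

/-- The block indicator process of a configuration of thresholds: `e ↦ [e ∈ u ∧ ∀ b ∈ B e, U b ≤ q]`
(«every bond of the block `B e` is open at level `q`»). -/
def blockInd (u : Set κ) (B : κ → Finset ι) (q : I) (U : ι → ℝ) : κ → Prop :=
  fun e => e ∈ u ∧ ∀ b ∈ B e, U b ≤ (q : ℝ)

/-- The per-coordinate threshold process on a `κ`-indexed family: `e ↦ [e ∈ u ∧ V e ≤ q^{|B e|}]`. -/
def blockThr (u : Set κ) (B : κ → Finset ι) (q : I) (V : κ → ℝ) : κ → Prop :=
  fun e => e ∈ u ∧ V e ≤ ((blockParam B q e : I) : ℝ)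

/-- The coordinate law shared by both processes. -/
noncomputable def blockLaw (u : Set κ) (B : κ → Finset ι) (q : I) (e : κ) : Measure Prop :=
  unif.map (fun x : ℝ => (e ∈ u ∧ x ≤ ((blockParam B q e : I) : ℝ)))

/-- One coordinate of the block indicator process is measurable (a finite intersection of
half-spaces). -/
theorem measurable_blockInd_coord (u : Set κ) (B : κ → Finset ι) (q : I) (e : κ) :
    Measurable fun U : ι → ℝ => blockInd u B q U e := by
  rw [← measurableSet_setOf]
  have h1 : {U : ι → ℝ | blockInd u B q U e} =
      {U : ι → ℝ | e ∈ u} ∩ ⋂ b ∈ B e, {U : ι → ℝ | U b ≤ (q : ℝ)} := by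
    ext U
    simp only [blockInd, mem_setOf_eq, mem_inter_iff, mem_iInter]
  rw [h1]
  exact (MeasurableSet.const _).inter
    ((B e).measurableSet_biInter fun b _ => measurableSet_le (measurable_pi_apply b) measurable_const)

/-- The block indicator process is measurable. -/
theorem measurable_blockInd (u : Set κ) (B : κ → Finset ι) (q : I) :
    Measurable (blockInd u B q) :=
  measurable_pi_lambda _ fun e => measurable_blockInd_coord u B q e

/-- The per-coordinate threshold process is measurable. -/
theorem measurable_blockThr (u : Set κ) (B : κ → Finset ι) (q : I) :
    Measurable (blockThr u B q) :=
  measurable_pi_lambda _ fun e =>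
    (measurable_threshold_coord u (blockParam B q e) e).comp (measurable_pi_apply e)

/-- The per-coordinate threshold process has the product law of the coordinate laws. -/
theorem map_blockThr_eq (u : Set κ) (B : κ → Finset ι) (q : I) :
    (Measure.infinitePi fun _ : κ => unif).map (blockThr u B q) =
      Measure.infinitePi (blockLaw u B q) :=
  Measure.infinitePi_map_pi _ fun e => measurable_threshold_coord u (blockParam B q e) e

/-- A block, read on the bonds of its block: `x ↦ [e ∈ u ∧ ∀ b, x b ≤ q]`. -/
def blockFun (u : Set κ) (B : κ → Finset ι) (q : I) (e : κ) (x : ↥(B e) → ℝ) : Prop :=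
  e ∈ u ∧ ∀ b, x b ≤ (q : ℝ)

/-- A block, read on its own bonds, is measurable. -/
theorem measurable_blockFun (u : Set κ) (B : κ → Finset ι) (q : I) (e : κ) :
    Measurable (blockFun u B q e) := by
  rw [← measurableSet_setOf]
  have h1 : {x : ↥(B e) → ℝ | blockFun u B q e x} =
      {x : ↥(B e) → ℝ | e ∈ u} ∩ ⋂ b, {x : ↥(B e) → ℝ | x b ≤ (q : ℝ)} := by
    ext x
    simp only [blockFun, mem_setOf_eq, mem_inter_iff, mem_iInter]
  rw [h1]
  exact (MeasurableSet.const _).inter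
    (MeasurableSet.iInter fun b => measurableSet_le (measurable_pi_apply b) measurable_const)

/-- Two probability measures on `Prop` agreeing on `{True}` agree. -/
theorem measure_prop_ext {μ ν : Measure Prop} [IsProbabilityMeasure μ] [IsProbabilityMeasure ν]
    (h : μ {True} = ν {True}) : μ = ν := by
  refine Measure.ext_of_singleton fun r => ?_
  by_cases hr : r
  · rw [eq_true hr, h]
  · rw [eq_false hr]
    have hc : ({False} : Set Prop) = {True}ᶜ := by
      ext p
      simp [eq_iff_iff]
    rw [hc, measure_compl (measurableSet_singleton _) (measure_ne_top _ _),
      measure_compl (measurableSet_singleton _) (measure_ne_top _ _), measure_univ, measure_univ, h]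

/-- The mass of `{True}` under the coordinate law on `u`: `q^{|B e|}`. -/
theorem blockLaw_true_of_mem (u : Set κ) (B : κ → Finset ι) (q : I) {e : κ} (he : e ∈ u) :
    blockLaw u B q e {True} = ENNReal.ofReal ((q : ℝ) ^ (B e).card) := by
  rw [blockLaw, Measure.map_apply (measurable_threshold_coord u _ e) (measurableSet_singleton _)]
  have hpre : (fun x : ℝ => (e ∈ u ∧ x ≤ ((blockParam B q e : I) : ℝ))) ⁻¹' {True} =
      Iic ((blockParam B q e : I) : ℝ) := by
    ext x
    simp [he]
  rw [hpre, unif_Iic, blockParam, Set.Icc.coe_pow]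

/-- The mass of `{True}` under the coordinate law off `u`: `0`. -/
theorem blockLaw_true_of_not_mem (u : Set κ) (B : κ → Finset ι) (q : I) {e : κ} (he : e ∉ u) :
    blockLaw u B q e {True} = 0 := by
  rw [blockLaw, Measure.map_apply (measurable_threshold_coord u _ e) (measurableSet_singleton _)]
  have hpre : (fun x : ℝ => (e ∈ u ∧ x ≤ ((blockParam B q e : I) : ℝ))) ⁻¹' {True} = ∅ := by
    ext x
    simp [he]
  rw [hpre, measure_empty]

/-- The law of one block indicator under the uniform family on its block is the coordinate law. -/
theorem map_blockFun_eq (u : Set κ) (B : κ → Finset ι) (q : I) (e : κ) :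
    (Measure.infinitePi fun _ : ↥(B e) => unif).map (blockFun u B q e) = blockLaw u B q e := by
  haveI : IsProbabilityMeasure ((Measure.infinitePi fun _ : ↥(B e) => unif).map (blockFun u B q e)) :=
    Measure.isProbabilityMeasure_map (measurable_blockFun u B q e).aemeasurable
  haveI : IsProbabilityMeasure (blockLaw u B q e) :=
    Measure.isProbabilityMeasure_map (measurable_threshold_coord u _ e).aemeasurable
  refine measure_prop_ext ?_
  rw [Measure.map_apply (measurable_blockFun u B q e) (measurableSet_singleton _)]
  by_cases he : e ∈ u
  · have hpre : blockFun u B q e ⁻¹' {True} = Set.pi Set.univ fun _ : ↥(B e) => Iic (q : ℝ) := by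
      ext x
      simp only [Set.mem_preimage, Set.mem_singleton_iff, eq_iff_iff, iff_true, Set.mem_pi,
        Set.mem_univ, Set.mem_Iic, true_implies, blockFun, he, true_and]
    rw [hpre, Measure.infinitePi_eq_pi, Measure.pi_pi, blockLaw_true_of_mem u B q he]
    simp only [unif_Iic, Finset.prod_const, Finset.card_univ, Fintype.card_coe]
    rw [ENNReal.ofReal_pow q.2.1]
  · have hpre : blockFun u B q e ⁻¹' {True} = ∅ := by
      ext x
      simp [blockFun, he]
    rw [hpre, measure_empty, blockLaw_true_of_not_mem u B q he]

/-- The re-indexing of the bonds along the blocks: `⟨e, b⟩ ↦ b`. -/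
def blockIndex (B : κ → Finset ι) (p : (e : κ) × ↥(B e)) : ι := p.2.1

/-- Pairwise disjoint blocks: the re-indexing is injective. -/
theorem blockIndex_injective {B : κ → Finset ι} (hB : Pairwise fun e e' => Disjoint (B e) (B e')) :
    Function.Injective (blockIndex B) := by
  intro p p' h
  obtain ⟨e, b⟩ := p
  obtain ⟨e', b'⟩ := p'
  have hbb : (b : ι) = b' := h
  by_cases hee : e = e'
  · subst hee
    rw [Subtype.ext hbb]
  · have hmem : (b : ι) ∈ B e' := by
      rw [hbb]
      exact b'.2
    exact absurd hmem (Finset.disjoint_left.1 (hB hee) b.2)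

/-- The block indicator process factors through the re-indexing along the blocks, the currying of
the product, and the blocks read on their own bonds. -/
theorem blockInd_eq_comp (u : Set κ) (B : κ → Finset ι) (q : I) :
    blockInd u B q = (fun x : (e : κ) → (↥(B e) → ℝ) => fun e => blockFun u B q e (x e)) ∘
      ⇑(MeasurableEquiv.piCurry fun (e : κ) (_ : ↥(B e)) => ℝ) ∘
      (fun (U : ι → ℝ) (p : (e : κ) × ↥(B e)) => U (blockIndex B p)) := by
  funext U e
  simp only [Function.comp_apply, MeasurableEquiv.coe_piCurry, Sigma.curry, blockInd, blockFun,
    blockIndex]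
  simp only [Subtype.forall]

/-- THE LAW OF THE BLOCK INDICATORS: under the uniform family on `ι`, the indicators of pairwise
disjoint blocks are independent with the coordinate laws `blockLaw` — the same product law as the
per-coordinate threshold process `blockThr` on a uniform family indexed by `κ`. -/
theorem map_blockInd_eq (u : Set κ) {B : κ → Finset ι} (hB : Pairwise fun e e' => Disjoint (B e) (B e'))
    (q : I) :
    (Measure.infinitePi fun _ : ι => unif).map (blockInd u B q) =
      Measure.infinitePi (blockLaw u B q) := by
  have hm1 : Measurable fun (U : ι → ℝ) (p : (e : κ) × ↥(B e)) => U (blockIndex B p) :=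
    measurable_pi_lambda _ fun p => measurable_pi_apply (blockIndex B p)
  have hm2 : Measurable (MeasurableEquiv.piCurry fun (e : κ) (_ : ↥(B e)) => ℝ) :=
    MeasurableEquiv.measurable _
  have hm3 : Measurable fun x : (e : κ) → (↥(B e) → ℝ) => fun e => blockFun u B q e (x e) :=
    measurable_pi_lambda _ fun e => (measurable_blockFun u B q e).comp (measurable_pi_apply e)
  have h1 : (Measure.infinitePi fun _ : ι => unif).map
      (fun (U : ι → ℝ) (p : (e : κ) × ↥(B e)) => U (blockIndex B p)) =
      Measure.infinitePi fun _ : (e : κ) × ↥(B e) => unif :=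
    Measure.map_infinitePi_infinitePi_of_inj (P := fun _ : ι => unif) (blockIndex_injective hB)
  have h2 : (Measure.infinitePi fun _ : (e : κ) × ↥(B e) => unif).map
      (MeasurableEquiv.piCurry fun (e : κ) (_ : ↥(B e)) => ℝ) =
      Measure.infinitePi fun e : κ => Measure.infinitePi fun _ : ↥(B e) => unif :=
    Measure.infinitePi_map_piCurry (fun (e : κ) (_ : ↥(B e)) => unif)
  have h3 : (Measure.infinitePi fun e : κ => Measure.infinitePi fun _ : ↥(B e) => unif).map
      (fun x : (e : κ) → (↥(B e) → ℝ) => fun e => blockFun u B q e (x e)) =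
      Measure.infinitePi fun e : κ => (Measure.infinitePi fun _ : ↥(B e) => unif).map (blockFun u B q e) :=
    Measure.infinitePi_map_pi _ (fun e => measurable_blockFun u B q e)
  rw [blockInd_eq_comp, ← Measure.map_map hm3 (hm2.comp hm1), ← Measure.map_map hm2 hm1, h1, h2, h3]
  congr 1
  funext e
  exact map_blockFun_eq u B q e

/-- The block configuration `{e : every bond of `B e` is open at level `q`}` of a threshold family. -/
def blockConfig (u : Set κ) (B : κ → Finset ι) (q : I) (U : ι → ℝ) : Set κ :=
  {e | blockInd u B q U e}

/-- The block configuration is a measurable map into `Set κ`. -/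
theorem measurable_blockConfig (u : Set κ) (B : κ → Finset ι) (q : I) :
    Measurable (blockConfig u B q) :=
  measurable_setOf.comp (measurable_blockInd u B q)

/-- Pointwise: the Bernoulli(`q^K`) threshold configuration lies inside the per-coordinate threshold
configuration when every block on `u` has at most `K` bonds. -/
theorem threshold_pow_subset_blockThr (u : Set κ) (B : κ → Finset ι) (q : I) {K : ℕ}
    (hcard : ∀ e ∈ u, (B e).card ≤ K) (V : κ → ℝ) :
    threshold u (q ^ K) V ⊆ {e | blockThr u B q V e} := by
  intro e he
  refine ⟨he.1, he.2.trans ?_⟩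
  rw [blockParam, Set.Icc.coe_pow, Set.Icc.coe_pow]
  exact pow_le_pow_of_le_one q.2.1 q.2.2 (hcard e he.1)

/-- STOCHASTIC DOMINATION: for an increasing measurable event `A`, the Bernoulli(`q^K`) measure of
`A` is at most the probability that the block configuration of the uniform family lies in `A`
(blocks pairwise disjoint, of size at most `K` on `u`). -/
theorem setBernoulli_pow_le_map_blockConfig (u : Set κ) {B : κ → Finset ι}
    (hB : Pairwise fun e e' => Disjoint (B e) (B e')) (q : I) {K : ℕ}
    (hcard : ∀ e ∈ u, (B e).card ≤ K) {A : Set (Set κ)} (hA : IsUpperSet A) (hAm : MeasurableSet A) :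
    setBernoulli u (q ^ K) A ≤ ((Measure.infinitePi fun _ : ι => unif).map (blockConfig u B q)) A := by
  have hthr : Measurable fun V : κ → ℝ => {e | blockThr u B q V e} :=
    measurable_setOf.comp (measurable_blockThr u B q)
  calc setBernoulli u (q ^ K) A
      = (Measure.infinitePi fun _ : κ => unif) (threshold u (q ^ K) ⁻¹' A) := by
        rw [← map_threshold_eq_setBernoulli u (q ^ K),
          Measure.map_apply (measurable_threshold u (q ^ K)) hAm]
    _ ≤ (Measure.infinitePi fun _ : κ => unif) ((fun V => {e | blockThr u B q V e}) ⁻¹' A) :=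
        measure_mono fun V hV => hA (threshold_pow_subset_blockThr u B q hcard V) hV
    _ = ((Measure.infinitePi fun _ : κ => unif).map (fun V => {e | blockThr u B q V e})) A := by
        rw [Measure.map_apply hthr hAm]
    _ = (((Measure.infinitePi fun _ : κ => unif).map (blockThr u B q)).map setOf) A := by
        rw [Measure.map_map measurable_setOf (measurable_blockThr u B q)]
        rfl
    _ = (((Measure.infinitePi fun _ : ι => unif).map (blockInd u B q)).map setOf) A := by
        rw [map_blockThr_eq, map_blockInd_eq u hB q]
    _ = ((Measure.infinitePi fun _ : ι => unif).map (blockConfig u B q)) A := by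
        rw [Measure.map_map measurable_setOf (measurable_blockInd u B q)]
        rfl

end Summit.Ventures.PercRepro0.SubdivisionLaw
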